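import Literature.MathematicalPhysics.QuantumFieldTheory.ONVectorSumRule

/-!
# The `O(N)` archipelago system: crossing symmetry of `⟨φᵢφⱼφₖφₗ⟩`, `⟨φᵢφⱼ s s⟩`, `⟨s s s s⟩` as seven
# equations — the vectors `V⃗_T, V⃗_A, V⃗_V`, the `2 × 2`-matrix vector `V⃗_S` — and the semidefinite
# exclusion step (Kos–Poland–Simmons-Duffin–Vichi, JHEP 11 (2015) 106, §2, §2.1, §2.2)

Topic `MathematicalPhysics/QuantumFieldTheory`; definitions + theorems only (no named fact, no instance,
no `sorry`).  The mixed-correlator sequel of `ONVectorSumRule.lean` [KosPolandSimmonsduffin2014ON], whose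
tensor structures `tS, tT, tA`, crossing combinations `Fm`/`Fp` (`F^∓`) and single-correlator theorem
`crossingAt_iff_sumRuleAt` are imported and reused, not re-proved.  As there: pure finite-dimensional
algebra over opaque "channel functions" `g : ℝ → ℝ → ℝ` of the cross-ratios — no conformal-block theory
is used or asserted (for the `ℤ₂` system `σ–ε` the analogous, much finer statements are
`ConformalBootstrap3D/SigmaEpsilonSystem.lean` and `ConformalBootstrap3D/DualFunctional.lean`).

SOURCE (read from the held text `paper:arxiv-1504.07997`, §2 "Crossing Symmetry with Multiple
Correlators", §2.1 "O(N) Models", §2.2 "Bounds from Semidefinite Programming").  F. Kos, D. Poland,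
D. Simmons-Duffin, A. Vichi, *Bootstrapping the O(N) archipelago*, JHEP 11 (2015) 106
[KosPolandSimmonsDuffinVichi2015]:
* §2: for scalars `φ_i` of dimensions `Δ_i` (no symmetry assumed yet), `Δ_ij ≡ Δ_i − Δ_j`,
  `⟨φ_i(x₁)φ_j(x₂)φ_k(x₃)φ_l(x₄)⟩ = x₁₂^{−Δ_i−Δ_j} x₃₄^{−Δ_k−Δ_l} (x₂₄/x₁₄)^{Δ_ij} (x₁₄/x₁₃)^{Δ_kl}
   Σ_𝒪 λ_{ij𝒪}λ_{kl𝒪} g^{Δ_ij,Δ_kl}_{Δ,ℓ}(u,v)`; "We also have the symmetry property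
  `λ_{ij𝒪} = (−1)^ℓ λ_{ji𝒪}`"; "exchanging `(1,i) ↔ (3,k)` gives the conditions
  `v^{(Δ_k+Δ_j)/2} Σ_𝒪 λ_{ij𝒪}λ_{kl𝒪} g^{Δ_ij,Δ_kl}(u,v) = u^{(Δ_i+Δ_j)/2} Σ_𝒪 λ_{kj𝒪}λ_{il𝒪} g^{Δ_kj,Δ_il}(v,u)`.
  It is convenient to symmetrize/anti-symmetrize in `u,v`, which leads to the two equations
  `0 = Σ_𝒪 [λ_{ij𝒪}λ_{kl𝒪} F^{ij,kl}_{∓,Δ,ℓ}(u,v) ± λ_{kj𝒪}λ_{il𝒪} F^{kj,il}_{∓,Δ,ℓ}(u,v)]`, where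
  `F^{ij,kl}_{∓,Δ,ℓ}(u,v) ≡ v^{(Δ_k+Δ_j)/2} g^{Δ_ij,Δ_kl}(u,v) ∓ u^{(Δ_k+Δ_j)/2} g^{Δ_ij,Δ_kl}(v,u)`"
  [cite: KosPolandSimmonsDuffinVichi2015, §2 (crossing equation and `F^{ij,kl}_∓`)].
* §2.1: `φ_i` an `O(N)` vector, `s` the lowest-dimension singlet scalar.  Footnote: "we are following the
  conformal block conventions of [Kos–Poland–Simmons-Duffin 2014, Ising], which contain a factor of
  `(−1)^ℓ` relative to the conventions used in the previous global symmetry studies … This leads to a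
  different sign in front of the contributions of the `𝒪_A` operators."  The index-structured equations
  `0 = (δ_ijδ_kl ± δ_jkδ_il) Σ_{S,ℓ⁺} λ² F_∓ + (…) Σ_{T,ℓ⁺} λ² F_∓
       + ((δ_ikδ_jl − δ_ilδ_jk) ± (δ_ikδ_jl − δ_ijδ_kl)) Σ_{A,ℓ⁻} λ² F_∓`;
  "we consider the four-point functions `⟨φ_iφ_j s s⟩` and `⟨ssss⟩`, which give rise to four additional
  sum rules after grouping the terms with the same index structure. In total this leads to a system of
  seven equations:
  `0 = Σ_{T⁺} λ² F^{φφ,φφ}_- + Σ_{A⁻} λ² F^{φφ,φφ}_-`,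
  `0 = Σ_{S⁺} λ²_{φφ𝒪} F^{φφ,φφ}_- + (1 − 2/N) Σ_{T⁺} λ² F^{φφ,φφ}_- − Σ_{A⁻} λ² F^{φφ,φφ}_-`,
  `0 = Σ_{S⁺} λ²_{φφ𝒪} F^{φφ,φφ}_+ − (1 + 2/N) Σ_{T⁺} λ² F^{φφ,φφ}_+ + Σ_{A⁻} λ² F^{φφ,φφ}_+`,
  `0 = Σ_{S⁺} λ²_{ss𝒪} F^{ss,ss}_-`,  `0 = Σ_{V,ℓ^±} λ²_{φs𝒪} F^{φs,φs}_-`,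
  `0 = Σ_{S⁺} λ_{φφ𝒪}λ_{ss𝒪} F^{φφ,ss}_∓ ± Σ_{V,ℓ^±} (−1)^ℓ λ²_{φs𝒪} F^{sφ,φs}_∓`.
  Note that the final line represents two equations"; "in vector notation
  `0 = Σ_{S⁺} (λ_{φφ𝒪} λ_{ss𝒪}) V⃗_S (λ_{φφ𝒪}; λ_{ss𝒪}) + Σ_{T⁺} λ² V⃗_T + Σ_{A⁻} λ² V⃗_A + Σ_{V} λ² V⃗_V`,
  where `V⃗_T, V⃗_A, V⃗_V` are 7-dimensional vectors and `V⃗_S` is a 7-vector of `2 × 2` matrices":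
  `V⃗_T = (F_-, (1−2/N)F_-, −(1+2/N)F_+, 0,0,0,0)ᵀ`, `V⃗_A = (F_-, −F_-, F_+, 0,0,0,0)ᵀ`,
  `V⃗_V = (0,0,0,0, F^{φs,φs}_-, (−1)^ℓ F^{sφ,φs}_-, −(−1)^ℓ F^{sφ,φs}_+)ᵀ`,
  `V⃗_S = (0, diag(F^{φφ,φφ}_-, 0), diag(F^{φφ,φφ}_+, 0), diag(0, F^{ss,ss}_-), 0, offdiag(½F^{φφ,ss}_-),
   offdiag(½F^{φφ,ss}_+))`
  [cite: KosPolandSimmonsDuffinVichi2015, §2.1 (seven equations; `V⃗_T, V⃗_A, V⃗_V, V⃗_S`)].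
* §2.2: "To rule out a hypothetical CFT spectrum, we must find a vector of linear functionals
  `α⃗ = (α₁, α₂, …, α₇)` such that `(1 1) α⃗·V⃗_{S,0,0} (1 1)ᵀ ≥ 0` for the identity operator,
  `α⃗·V⃗_{T,Δ,ℓ} ≥ 0` for all traceless symmetric tensors with `ℓ` even, `α⃗·V⃗_{A,Δ,ℓ} ≥ 0` for all
  antisymmetric tensors with `ℓ` odd, `α⃗·V⃗_{V,Δ,ℓ} ≥ 0` for all `O(N)` vectors with any `ℓ`,
  `α⃗·V⃗_{S,Δ,ℓ} ⪰ 0` for all singlets with `ℓ` even.  Here, the notation `⪰ 0` means 'is positive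
  semidefinite.'  If such a functional exists for a hypothetical CFT spectrum, then that spectrum is
  inconsistent with crossing symmetry" [cite: KosPolandSimmonsDuffinVichi2015, §2.2 (functional conditions)].

RENDERING (as in `ONVectorSumRule.lean`).  The cross-ratios `(u,v)` are real variables; a channel function
is any `g : ℝ → ℝ → ℝ`; `F^{ij,kl}_∓[g]` with prefactor exponent `a = (Δ_k+Δ_j)/2` is the imported
`Fm a g` / `Fp a g`.  CHANNEL SUMS.  An exchanged singlet `𝒪` carries ONE channel function
`g_𝒪 = g^{0,0}_𝒪` (it enters `⟨φφφφ⟩`, `⟨ssss⟩` and `⟨φφss⟩` alike, `Δ_12 = Δ_34 = 0` in all three) and the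
two couplings `(λ_{φφ𝒪}, λ_{ss𝒪})`, so the singlet channel has three channel sums
`G^{φφ}_S = Σ λ²_{φφ𝒪} g_𝒪`, `G^{φs}_S = Σ λ_{φφ𝒪}λ_{ss𝒪} g_𝒪`, `G^{ss}_S = Σ λ²_{ss𝒪} g_𝒪` (unit operator
`λ = (1,1)`, `g ≡ 1` included); `G_T = Σ_{T⁺} λ² g`, `G_A = Σ_{A⁻} λ² g`; an `O(N)` vector `𝒪 ∈ φ × s`
carries `λ²_{φs𝒪} ≥ 0`, a sign `ε_𝒪` (`= (−1)^ℓ`, from `λ_{sφ𝒪} = (−1)^ℓ λ_{φs𝒪}`) and TWO channel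
functions, `g₁ = g^{Δ_φs,Δ_φs}_𝒪` with channel sum `G_{V,1} = Σ λ² g₁` (the `(12)(34)` channel of
`⟨φ_i s φ_j s⟩`) and `g₂ = g^{Δ_sφ,Δ_φs}_𝒪` with `G_{V,2} = Σ λ_{sφ𝒪}λ_{φs𝒪} g₂ = Σ ε λ² g₂` (that of
`⟨s φ_j φ_i s⟩`).  The correlators `⟨φ_iφ_j s s⟩` and `⟨φ_i s φ_j s⟩` carry the single invariant tensor
`δ_ij`, so their crossing equations are scalar equations for its coefficient and are written for the
coefficient directly (`MixedCrossingAt`, the §2 equation at channel-sum level; nothing is lost for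
`N ≥ 1`).  `⟨φφφφ⟩` is expanded IN THE BLOCK CONVENTION OF THIS SOURCE: antisymmetric structure
`δ_ikδ_jl − δ_ilδ_jk = −tA` (`corr₄`, `CrossingPhi4At`); `crossingPhi4At_iff` is the dictionary
`G_A ↦ −G_A` to the imported 2014 convention (the footnote quoted above).  The placement of `(−1)^ℓ`
inside `V⃗_V` is the source's, for the source's blocks; with opaque channel functions it is bookkeeping
(it can be absorbed into `g₂`) — what the placement means once blocks are fixed to be non-negative double
series is the ERRATUM paragraph of `SigmaEpsilonData.SatisfiesCrossing` and is not touched here.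

WHAT IS PROVED.
* §1 (source §2) `MixedCrossingAt a b A B u v : v^a A(u,v) = u^b B(v,u)`; `mixedCrossingAt_swap_iff` —
  the condition at the mirror point `(v,u)` is crossing of the crossed correlator at `(u,v)`;
  **`mixedCrossingAt_pair_iff`** — the pair {at `(u,v)`, at `(v,u)`} IS the pair of symmetrised
  equations `F_-[A] + F_-[B] = 0`, `F_+[A] − F_+[B] = 0` (the "symmetrize/anti-symmetrize" step, an
  equivalence); `mixedCrossingAt_self_iff` (equal channels: `F_-[A] = 0` alone).
* §2 (source §2.1) the verbatim vectors `V7T`, `V7A`, `V7V`, the matrix vector `V7S` and its entry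
  vectors `VS11`, `VS12`, `VS22` (`V7S_apply`); the singlet term `quadVS a b g = (a b) V⃗_S[g] (a b)ᵀ`, its
  closed form `quadVS_eq` and the identity term `quadVS_unit`; the seven rows at channel-sum level
  `mixedVec` and `mixedVec_eq_parts` (`= singletVec + V7T[G_T] + V7A[G_A] + vectorVec`);
  `SystemCrossingAt` — crossing symmetry of `⟨φφφφ⟩` (at `(u,v)`), of `⟨ssss⟩`, of `⟨φsφs⟩`, and of
  `⟨φφss⟩` at `(u,v)` AND `(v,u)` — and **`systemCrossingAt_iff`**: for `2 ≤ N` it IS `mixedVec = 0`,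
  the seven equations, channel sums and all (rows 1–3 are the imported single-correlator theorem under
  `G_A ↦ −G_A`, `crossingPhi4At_iff_rows`).
* §3 operator level: `V7T`, `V7A`, `V7V`, `quadVS` commute with convergent channel expansions
  (`hasSum_V7T`, `hasSum_V7A`, `hasSum_V7V`, `hasSum_quadVS`), whence the source's vector equation as
  `HasSum` statements plus the vanishing of the limits (`mixedSumRule_hasSum`).
* §4 (source §2.2) `alphaVS α g = α⃗·V⃗_S[g]` (`α` applied entrywise), `alphaVS_quadForm`
  (`(a b) α⃗·V⃗_S (a b)ᵀ = α((a b) V⃗_S (a b)ᵀ)`), `quadVS_nonneg_of_posSemidef` (`⪰ 0` makes every singlet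
  term `≥ 0` whatever the signs of `λ_{φφ𝒪}, λ_{ss𝒪}` — the point of the matrix condition);
  **`false_of_functional₇`** — a linear functional on 7-vectors of channel functions satisfying the five
  displayed conditions, vanishing on the channel-level sum rule and APPLYING TERMWISE to the four channel
  series, cannot exist; `pointFunctional₇` / `hasSum_pointFunctional₇` (finite combinations of point
  evaluations apply termwise with no hypothesis) and **`false_of_pointFunctional₇`**, the complete
  hypothesis-explicit exclusion for them (channel expansions at the evaluation points and their mirrors +
  crossing there + the five conditions ⇒ `False`).  STRICTNESS: the source's list prints `≥ 0` on the
  identity line; its concluding sentence needs the identity value to be non-zero (with `α⃗ = 0` every line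
  holds), i.e. `> 0`, as printed in the companion paper [KosPolandSimmonsduffin2014ON, §2.2:
  "`α(V_unit) > 0`"] — the theorems assume the strict form.
NOT COVERED: derivative functionals at `z = z̄ = 1/2` (the source's search space, §2.2 and App. A) need
termwise differentiability of the channel expansions, not supplied here (cf. `AppliesTermwise` in
`ConformalBootstrap3D/DualFunctional.lean`); the unitarity bounds and gap assumptions of §2.2 are "the
hypothetical spectrum", i.e. the user's choice of index sets; §2.1.1 (`SO(N)` versus `O(N)`), the system
with external `t_{ij}`, and everything numerical (§3–§4, the islands) are not formalised.
-/

namespace Literature.MathematicalPhysics.QuantumFieldTheory.ONMixedSumRule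

open Finset Matrix
open Literature.MathematicalPhysics.QuantumFieldTheory.ONVectorSumRule

noncomputable section

variable {N : ℕ}

/-! ## §1 Crossing for scalars of unequal dimensions and its symmetrisation (source §2) -/

/-- Crossing symmetry under `(1,i) ↔ (3,k)` at the point `(u,v)`, at channel-sum level, for external
scalars of unequal dimensions: with `A(u,v) = Σ_𝒪 λ_{ij𝒪}λ_{kl𝒪} g^{Δ_ij,Δ_kl}_𝒪(u,v)` the `(12)(34)`-channel
sum of the reduced correlator and `B(u,v) = Σ_𝒪 λ_{kj𝒪}λ_{il𝒪} g^{Δ_kj,Δ_il}_𝒪(u,v)` that of the crossed one,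
`v^{a} A(u,v) = u^{b} B(v,u)` with `a = (Δ_k+Δ_j)/2`, `b = (Δ_i+Δ_j)/2`.
[cite: KosPolandSimmonsDuffinVichi2015, §2 (crossing equation)] -/
def MixedCrossingAt (a b : ℝ) (A B : ℝ → ℝ → ℝ) (u v : ℝ) : Prop :=
  v ^ a * A u v = u ^ b * B v u

/-- The condition at the mirror point `(v,u)` is the crossing equation of the crossed correlator (channel
sums `B, A`, exponents `b, a`) at `(u,v)`. [cite: KosPolandSimmonsDuffinVichi2015, §2 (crossing equation)] -/
theorem mixedCrossingAt_swap_iff (a b : ℝ) (A B : ℝ → ℝ → ℝ) (u v : ℝ) :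
    MixedCrossingAt a b A B v u ↔ MixedCrossingAt b a B A u v := by
  simp only [MixedCrossingAt]
  constructor <;> intro h <;> exact h.symm

/-- **"It is convenient to symmetrize/anti-symmetrize in `u, v`, which leads to the two equations"**:
crossing at `(u,v)` together with crossing at `(v,u)` IS the pair
`F_-[A](u,v) + F_-[B](u,v) = 0`, `F_+[A](u,v) − F_+[B](u,v) = 0` (`F_∓[A] = F^{ij,kl}_∓`, exponent `a`;
`F_∓[B] = F^{kj,il}_∓`, exponent `b`). [cite: KosPolandSimmonsDuffinVichi2015, §2 (`F^{ij,kl}_∓`)] -/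
theorem mixedCrossingAt_pair_iff (a b : ℝ) (A B : ℝ → ℝ → ℝ) (u v : ℝ) :
    (MixedCrossingAt a b A B u v ∧ MixedCrossingAt a b A B v u) ↔
      (Fm a A u v + Fm b B u v = 0 ∧ Fp a A u v - Fp b B u v = 0) := by
  simp only [MixedCrossingAt, Fm, Fp]
  constructor
  · rintro ⟨h1, h2⟩
    exact ⟨by linarith, by linarith⟩
  · rintro ⟨h1, h2⟩
    exact ⟨by linarith, by linarith⟩

/-- Equal channels on both sides (`⟨ssss⟩`, `⟨φ_i s φ_j s⟩`): crossing at `(u,v)` is `F_-[A](u,v) = 0`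
(and then holds at `(v,u)` as well). [cite: KosPolandSimmonsDuffinVichi2015, §2 (`F^{ij,kl}_∓`)] -/
theorem mixedCrossingAt_self_iff (a : ℝ) (A : ℝ → ℝ → ℝ) (u v : ℝ) :
    MixedCrossingAt a a A A u v ↔ Fm a A u v = 0 := by
  simp only [MixedCrossingAt, Fm]
  constructor <;> intro h <;> linarith

/-! ## §2 The `O(N)`–singlet system: `V⃗_T, V⃗_A, V⃗_V, V⃗_S` and crossing ⟺ seven equations (source §2.1) -/

/-- The reduced correlator `⟨φᵢφⱼφₖφₗ⟩` expanded on the three tensor structures IN THE BLOCK CONVENTION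
OF THE SOURCE: the antisymmetric channel enters with `δᵢₖδⱼₗ − δᵢₗδⱼₖ = −tA` (footnote of §2.1: a factor
`(−1)^ℓ` relative to the 2014 conventions, i.e. a sign on the odd-spin `𝒪_A` contributions).
[cite: KosPolandSimmonsDuffinVichi2015, §2.1 (index-structured equations, footnote on conventions)] -/
def corr₄ (GS GT GA : ℝ → ℝ → ℝ) (i j k l : Fin N) (u v : ℝ) : ℝ :=
  tS i j k l * GS u v + tT i j k l * GT u v - tA i j k l * GA u v

/-- Dictionary to the imported 2014 convention: `corr₄[G_S, G_T, G_A] = corr[G_S, G_T, −G_A]`.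
[cite: KosPolandSimmonsDuffinVichi2015, §2.1 (footnote on conventions)] -/
theorem corr₄_eq (GS GT GA : ℝ → ℝ → ℝ) (i j k l : Fin N) (u v : ℝ) :
    corr₄ GS GT GA i j k l u v = corr GS GT (-GA) i j k l u v := by
  simp only [corr₄, corr, Pi.neg_apply]
  ring

/-- Crossing symmetry of `⟨φᵢφⱼφₖφₗ⟩` under `(1,i) ↔ (3,k)` at `(u,v)` (source conventions):
`v^{Δφ} f_{ijkl}(u,v) = u^{Δφ} f_{kjil}(v,u)` for all indices.
[cite: KosPolandSimmonsDuffinVichi2015, §2.1 (index-structured equations)] -/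
def CrossingPhi4At (N : ℕ) (Δφ : ℝ) (GS GT GA : ℝ → ℝ → ℝ) (u v : ℝ) : Prop :=
  ∀ i j k l : Fin N, v ^ Δφ * corr₄ GS GT GA i j k l u v = u ^ Δφ * corr₄ GS GT GA k j i l v u

/-- `CrossingPhi4At` is the imported `CrossingAt` with `G_A ↦ −G_A`.
[cite: KosPolandSimmonsDuffinVichi2015, §2.1 (footnote on conventions)] -/
theorem crossingPhi4At_iff {Δφ : ℝ} {GS GT GA : ℝ → ℝ → ℝ} {u v : ℝ} :
    CrossingPhi4At N Δφ GS GT GA u v ↔ CrossingAt N Δφ GS GT (-GA) u v := by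
  simp only [CrossingPhi4At, CrossingAt, corr₄_eq]

/-- `F_-[−g] = −F_-[g]`. [cite: KosPolandSimmonsDuffinVichi2015, §2.1 (footnote on conventions)] -/
theorem Fm_neg (a : ℝ) (g : ℝ → ℝ → ℝ) (u v : ℝ) : Fm a (-g) u v = -Fm a g u v := by
  simp only [Fm, Pi.neg_apply]
  ring

/-- `F_+[−g] = −F_+[g]`. [cite: KosPolandSimmonsDuffinVichi2015, §2.1 (footnote on conventions)] -/
theorem Fp_neg (a : ℝ) (g : ℝ → ℝ → ℝ) (u v : ℝ) : Fp a (-g) u v = -Fp a g u v := by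
  simp only [Fp, Pi.neg_apply]
  ring

/-- `V⃗_T = (F^{φφ,φφ}_-, (1 − 2/N) F^{φφ,φφ}_-, −(1 + 2/N) F^{φφ,φφ}_+, 0, 0, 0, 0)ᵀ` (exponent `Δφ`).
[cite: KosPolandSimmonsDuffinVichi2015, §2.1 (`V⃗_T`)] -/
def V7T (N : ℕ) (Δφ : ℝ) (g : ℝ → ℝ → ℝ) (u v : ℝ) : Fin 7 → ℝ :=
  ![Fm Δφ g u v, (1 - 2 / (N : ℝ)) * Fm Δφ g u v, -(1 + 2 / (N : ℝ)) * Fp Δφ g u v, 0, 0, 0, 0]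

/-- `V⃗_A = (F^{φφ,φφ}_-, −F^{φφ,φφ}_-, F^{φφ,φφ}_+, 0, 0, 0, 0)ᵀ` (exponent `Δφ`; source conventions).
[cite: KosPolandSimmonsDuffinVichi2015, §2.1 (`V⃗_A`)] -/
def V7A (Δφ : ℝ) (g : ℝ → ℝ → ℝ) (u v : ℝ) : Fin 7 → ℝ :=
  ![Fm Δφ g u v, -Fm Δφ g u v, Fp Δφ g u v, 0, 0, 0, 0]

/-- `V⃗_V = (0, 0, 0, 0, F^{φs,φs}_-[g₁], ε F^{sφ,φs}_-[g₂], −ε F^{sφ,φs}_+[g₂])ᵀ` for an `O(N)` vector of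
spin `ℓ`, `ε = (−1)^ℓ`, `g₁ = g^{Δ_φs,Δ_φs}` (exponent `(Δφ+Δs)/2`), `g₂ = g^{Δ_sφ,Δ_φs}` (exponent `Δφ`).
[cite: KosPolandSimmonsDuffinVichi2015, §2.1 (`V⃗_V`)] -/
def V7V (Δφ Δs ε : ℝ) (g₁ g₂ : ℝ → ℝ → ℝ) (u v : ℝ) : Fin 7 → ℝ :=
  ![0, 0, 0, 0, Fm ((Δφ + Δs) / 2) g₁ u v, ε * Fm Δφ g₂ u v, -(ε * Fp Δφ g₂ u v)]

/-- `V⃗_S`, "a 7-vector of `2 × 2` matrices":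
`(0, diag(F^{φφ,φφ}_-, 0), diag(F^{φφ,φφ}_+, 0), diag(0, F^{ss,ss}_-), 0, offdiag(½ F^{φφ,ss}_-),
offdiag(½ F^{φφ,ss}_+))` for a singlet with channel function `g = g^{0,0}` (exponents `Δφ`, `Δs`,
`(Δφ+Δs)/2`). [cite: KosPolandSimmonsDuffinVichi2015, §2.1 (`V⃗_S`)] -/
def V7S (Δφ Δs : ℝ) (g : ℝ → ℝ → ℝ) (u v : ℝ) : Fin 7 → Matrix (Fin 2) (Fin 2) ℝ :=
  ![0, !![Fm Δφ g u v, 0; 0, 0], !![Fp Δφ g u v, 0; 0, 0], !![0, 0; 0, Fm Δs g u v], 0,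
    !![0, Fm ((Δφ + Δs) / 2) g u v / 2; Fm ((Δφ + Δs) / 2) g u v / 2, 0],
    !![0, Fp ((Δφ + Δs) / 2) g u v / 2; Fp ((Δφ + Δs) / 2) g u v / 2, 0]]

/-- The `(1,1)` entries of `V⃗_S[g]`: `(0, F^{φφ,φφ}_-, F^{φφ,φφ}_+, 0, 0, 0, 0)`.
[cite: KosPolandSimmonsDuffinVichi2015, §2.1 (`V⃗_S`)] -/
def VS11 (Δφ : ℝ) (g : ℝ → ℝ → ℝ) (u v : ℝ) : Fin 7 → ℝ := ![0, Fm Δφ g u v, Fp Δφ g u v, 0, 0, 0, 0]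

/-- The `(2,2)` entries of `V⃗_S[g]`: `(0, 0, 0, F^{ss,ss}_-, 0, 0, 0)`.
[cite: KosPolandSimmonsDuffinVichi2015, §2.1 (`V⃗_S`)] -/
def VS22 (Δs : ℝ) (g : ℝ → ℝ → ℝ) (u v : ℝ) : Fin 7 → ℝ := ![0, 0, 0, Fm Δs g u v, 0, 0, 0]

/-- The off-diagonal entries of `V⃗_S[g]`: `(0, 0, 0, 0, 0, ½ F^{φφ,ss}_-, ½ F^{φφ,ss}_+)`.
[cite: KosPolandSimmonsDuffinVichi2015, §2.1 (`V⃗_S`)] -/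
def VS12 (Δφ Δs : ℝ) (g : ℝ → ℝ → ℝ) (u v : ℝ) : Fin 7 → ℝ :=
  ![0, 0, 0, 0, 0, Fm ((Δφ + Δs) / 2) g u v / 2, Fp ((Δφ + Δs) / 2) g u v / 2]

/-- `V⃗_S[g]` entry by entry. [cite: KosPolandSimmonsDuffinVichi2015, §2.1 (`V⃗_S`)] -/
theorem V7S_apply (Δφ Δs : ℝ) (g : ℝ → ℝ → ℝ) (u v : ℝ) (r : Fin 7) :
    V7S Δφ Δs g u v r =
      !![VS11 Δφ g u v r, VS12 Δφ Δs g u v r; VS12 Δφ Δs g u v r, VS22 Δs g u v r] := by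
  ext i j
  fin_cases r <;> fin_cases i <;> fin_cases j <;> simp [V7S, VS11, VS12, VS22]

/-- The singlet term of the vector equation for an exchanged `𝒪` with `(λ_{φφ𝒪}, λ_{ss𝒪}) = (a, b)`:
the 7-vector `(a b) V⃗_S[g] (a b)ᵀ`. [cite: KosPolandSimmonsDuffinVichi2015, §2.1 (vector equation)] -/
def quadVS (Δφ Δs a b : ℝ) (g : ℝ → ℝ → ℝ) (u v : ℝ) : Fin 7 → ℝ :=
  fun r => ![a, b] ⬝ᵥ (V7S Δφ Δs g u v r *ᵥ ![a, b])

/-- Closed form of the singlet term: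
`(0, a² F^{φφ,φφ}_-, a² F^{φφ,φφ}_+, b² F^{ss,ss}_-, 0, a b F^{φφ,ss}_-, a b F^{φφ,ss}_+)` — the seven
printed equations with `a² = λ²_{φφ𝒪}`, `b² = λ²_{ss𝒪}`, `ab = λ_{φφ𝒪}λ_{ss𝒪}`.
[cite: KosPolandSimmonsDuffinVichi2015, §2.1 (seven equations)] -/
theorem quadVS_eq (Δφ Δs a b : ℝ) (g : ℝ → ℝ → ℝ) (u v : ℝ) :
    quadVS Δφ Δs a b g u v =
      ![0, a ^ 2 * Fm Δφ g u v, a ^ 2 * Fp Δφ g u v, b ^ 2 * Fm Δs g u v, 0,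
        a * b * Fm ((Δφ + Δs) / 2) g u v, a * b * Fp ((Δφ + Δs) / 2) g u v] := by
  funext r
  fin_cases r <;> simp [quadVS, V7S, Matrix.mulVec, dotProduct, Fin.sum_univ_two] <;> ring

/-- The singlet term through the entry vectors: `(a b) V⃗_S (a b)ᵀ = a² V₁₁ + 2ab V₁₂ + b² V₂₂`.
[cite: KosPolandSimmonsDuffinVichi2015, §2.1 (`V⃗_S`)] -/
theorem quadVS_eq_smul (Δφ Δs a b : ℝ) (g : ℝ → ℝ → ℝ) :
    quadVS Δφ Δs a b g = a ^ 2 • VS11 Δφ g + (2 * (a * b)) • VS12 Δφ Δs g + b ^ 2 • VS22 Δs g := by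
  funext u v r
  rw [quadVS_eq]
  fin_cases r <;> simp [VS11, VS12, VS22] <;> ring

/-- The identity operator (`λ_{φφ1} = λ_{ss1} = 1`, `g ≡ 1`) contributes `(1 1) V⃗_{S,0,0} (1 1)ᵀ =
(0, v^{Δφ} − u^{Δφ}, v^{Δφ} + u^{Δφ}, v^{Δs} − u^{Δs}, 0, v^{s} − u^{s}, v^{s} + u^{s})`, `s = (Δφ+Δs)/2`.
[cite: KosPolandSimmonsDuffinVichi2015, §2.2 (identity operator)] -/
theorem quadVS_unit (Δφ Δs u v : ℝ) :
    quadVS Δφ Δs 1 1 (fun _ _ => (1 : ℝ)) u v =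
      ![0, v ^ Δφ - u ^ Δφ, v ^ Δφ + u ^ Δφ, v ^ Δs - u ^ Δs, 0,
        v ^ ((Δφ + Δs) / 2) - u ^ ((Δφ + Δs) / 2), v ^ ((Δφ + Δs) / 2) + u ^ ((Δφ + Δs) / 2)] := by
  rw [quadVS_eq]
  funext r
  fin_cases r <;> simp [Fm, Fp]

/-- The singlet channel at channel-sum level, `Σ_{S} (λ_{φφ𝒪} λ_{ss𝒪}) V⃗_S[g_𝒪] (λ_{φφ𝒪}; λ_{ss𝒪})` summed:
`(0, F_-^{Δφ}[G^{φφ}], F_+^{Δφ}[G^{φφ}], F_-^{Δs}[G^{ss}], 0, F_-^{s}[G^{φs}], F_+^{s}[G^{φs}])` with the three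
singlet channel sums `G^{φφ}_S, G^{φs}_S, G^{ss}_S` (arguments in this order).
[cite: KosPolandSimmonsDuffinVichi2015, §2.1 (seven equations)] -/
def singletVec (Δφ Δs : ℝ) (G₁₁ G₁₂ G₂₂ : ℝ → ℝ → ℝ) (u v : ℝ) : Fin 7 → ℝ :=
  ![0, Fm Δφ G₁₁ u v, Fp Δφ G₁₁ u v, Fm Δs G₂₂ u v, 0,
    Fm ((Δφ + Δs) / 2) G₁₂ u v, Fp ((Δφ + Δs) / 2) G₁₂ u v]

/-- The `O(N)`-vector channel at channel-sum level, `Σ_V λ² V⃗_V` summed: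
`(0, 0, 0, 0, F_-^{s}[G_{V,1}], F_-^{Δφ}[G_{V,2}], −F_+^{Δφ}[G_{V,2}])` with `G_{V,1} = Σ λ² g₁`,
`G_{V,2} = Σ ε λ² g₂`. [cite: KosPolandSimmonsDuffinVichi2015, §2.1 (seven equations)] -/
def vectorVec (Δφ Δs : ℝ) (GV₁ GV₂ : ℝ → ℝ → ℝ) (u v : ℝ) : Fin 7 → ℝ :=
  ![0, 0, 0, 0, Fm ((Δφ + Δs) / 2) GV₁ u v, Fm Δφ GV₂ u v, -Fp Δφ GV₂ u v]

/-- **The seven equations at channel-sum level** (right-hand sides, verbatim rows of §2.1):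
`( F_-[G_T] + F_-[G_A],  F_-[G^{φφ}_S] + (1 − 2/N) F_-[G_T] − F_-[G_A],
   F_+[G^{φφ}_S] − (1 + 2/N) F_+[G_T] + F_+[G_A],  F_-^{Δs}[G^{ss}_S],  F_-^{s}[G_{V,1}],
   F_-^{s}[G^{φs}_S] + F_-^{Δφ}[G_{V,2}],  F_+^{s}[G^{φs}_S] − F_+^{Δφ}[G_{V,2}] )`, `s = (Δφ+Δs)/2`.
[cite: KosPolandSimmonsDuffinVichi2015, §2.1 (seven equations)] -/
def mixedVec (N : ℕ) (Δφ Δs : ℝ) (GSφφ GSss GSφs GT GA GV₁ GV₂ : ℝ → ℝ → ℝ) (u v : ℝ) :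
    Fin 7 → ℝ :=
  ![Fm Δφ GT u v + Fm Δφ GA u v,
    Fm Δφ GSφφ u v + (1 - 2 / (N : ℝ)) * Fm Δφ GT u v - Fm Δφ GA u v,
    Fp Δφ GSφφ u v - (1 + 2 / (N : ℝ)) * Fp Δφ GT u v + Fp Δφ GA u v,
    Fm Δs GSss u v,
    Fm ((Δφ + Δs) / 2) GV₁ u v,
    Fm ((Δφ + Δs) / 2) GSφs u v + Fm Δφ GV₂ u v,
    Fp ((Δφ + Δs) / 2) GSφs u v - Fp Δφ GV₂ u v]

/-- The seven rows are the vector equation at channel-sum level: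
`mixedVec = singletVec + V⃗_T[G_T] + V⃗_A[G_A] + vectorVec`.
[cite: KosPolandSimmonsDuffinVichi2015, §2.1 (vector equation)] -/
theorem mixedVec_eq_parts (Δφ Δs : ℝ) (GSφφ GSss GSφs GT GA GV₁ GV₂ : ℝ → ℝ → ℝ) (u v : ℝ) :
    mixedVec N Δφ Δs GSφφ GSss GSφs GT GA GV₁ GV₂ u v =
      singletVec Δφ Δs GSφφ GSφs GSss u v + V7T N Δφ GT u v + V7A Δφ GA u v +
        vectorVec Δφ Δs GV₁ GV₂ u v := by
  funext r
  fin_cases r <;> simp [mixedVec, singletVec, V7T, V7A, vectorVec] <;> ring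

/-- The same with the unit operator isolated in the singlet channel (as functions of `(u,v)`):
`mixedVec = (1 1) V⃗_{S,0,0} (1 1)ᵀ + singletVec[G^{φφ}_S − 1, G^{φs}_S − 1, G^{ss}_S − 1] + V⃗_T[G_T] + V⃗_A[G_A]
+ vectorVec`. [cite: KosPolandSimmonsDuffinVichi2015, §2.2 (identity operator)] -/
theorem mixedVec_unit_split (Δφ Δs : ℝ) (GSφφ GSss GSφs GT GA GV₁ GV₂ : ℝ → ℝ → ℝ) :
    mixedVec N Δφ Δs GSφφ GSss GSφs GT GA GV₁ GV₂ =
      quadVS Δφ Δs 1 1 (fun _ _ => (1 : ℝ)) +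
        singletVec Δφ Δs (fun u v => GSφφ u v - 1) (fun u v => GSφs u v - 1)
          (fun u v => GSss u v - 1) +
        V7T N Δφ GT + V7A Δφ GA + vectorVec Δφ Δs GV₁ GV₂ := by
  funext u v r
  simp only [Pi.add_apply, quadVS_eq]
  fin_cases r <;> simp [mixedVec, singletVec, V7T, V7A, vectorVec, Fm, Fp] <;> ring

/-- **Crossing symmetry of the system at `(u,v)`**: of `⟨φφφφ⟩` at `(u,v)` (source conventions), of
`⟨ssss⟩` at `(u,v)` (exponent `Δs`, channel sum `G^{ss}_S` on both sides), of `⟨φ_i s φ_j s⟩` at `(u,v)`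
(exponent `(Δφ+Δs)/2`, `G_{V,1}` on both sides), and of `⟨φ_iφ_j s s⟩` at `(u,v)` and at `(v,u)`
(exponents `(Δφ+Δs)/2` and `Δφ`; channel sums `G^{φs}_S` and `G_{V,2}`).
[cite: KosPolandSimmonsDuffinVichi2015, §2.1 (four-point functions `⟨φφss⟩`, `⟨ssss⟩`)] -/
def SystemCrossingAt (N : ℕ) (Δφ Δs : ℝ) (GSφφ GSss GSφs GT GA GV₁ GV₂ : ℝ → ℝ → ℝ) (u v : ℝ) :
    Prop :=
  CrossingPhi4At N Δφ GSφφ GT GA u v ∧ MixedCrossingAt Δs Δs GSss GSss u v ∧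
    MixedCrossingAt ((Δφ + Δs) / 2) ((Δφ + Δs) / 2) GV₁ GV₁ u v ∧
    MixedCrossingAt ((Δφ + Δs) / 2) Δφ GSφs GV₂ u v ∧ MixedCrossingAt ((Δφ + Δs) / 2) Δφ GSφs GV₂ v u

/-- Rows 1–3: for `2 ≤ N`, crossing of `⟨φφφφ⟩` at `(u,v)` is the three `⟨φφφφ⟩` equations with the
source's signs (the imported `crossingAt_iff_sumRuleAt` under `G_A ↦ −G_A`).
[cite: KosPolandSimmonsDuffinVichi2015, §2.1 (seven equations, rows 1–3)] -/
theorem crossingPhi4At_iff_rows (hN : 2 ≤ N) {Δφ : ℝ} {GS GT GA : ℝ → ℝ → ℝ} {u v : ℝ} :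
    CrossingPhi4At N Δφ GS GT GA u v ↔
      Fm Δφ GT u v + Fm Δφ GA u v = 0 ∧
        Fm Δφ GS u v + (1 - 2 / (N : ℝ)) * Fm Δφ GT u v - Fm Δφ GA u v = 0 ∧
        Fp Δφ GS u v - (1 + 2 / (N : ℝ)) * Fp Δφ GT u v + Fp Δφ GA u v = 0 := by
  rw [crossingPhi4At_iff, crossingAt_iff_sumRuleAt hN, sumRuleAt_iff, sumRuleVec_zero, sumRuleVec_one,
    sumRuleVec_two, Fm_neg, Fp_neg]
  constructor
  · rintro ⟨h0, h1, h2⟩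
    exact ⟨by linarith, by linarith, by linarith⟩
  · rintro ⟨h0, h1, h2⟩
    exact ⟨by linarith, by linarith, by linarith⟩

/-- **Crossing symmetry of the system at `(u,v)` IS the seven equations at `(u,v)`** (`2 ≤ N`), channel
sums and all. [cite: KosPolandSimmonsDuffinVichi2015, §2.1 (seven equations)] -/
theorem systemCrossingAt_iff (hN : 2 ≤ N) {Δφ Δs : ℝ} {GSφφ GSss GSφs GT GA GV₁ GV₂ : ℝ → ℝ → ℝ}
    {u v : ℝ} :
    SystemCrossingAt N Δφ Δs GSφφ GSss GSφs GT GA GV₁ GV₂ u v ↔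
      mixedVec N Δφ Δs GSφφ GSss GSφs GT GA GV₁ GV₂ u v = 0 := by
  have hp := mixedCrossingAt_pair_iff ((Δφ + Δs) / 2) Δφ GSφs GV₂ u v
  rw [SystemCrossingAt, crossingPhi4At_iff_rows hN, mixedCrossingAt_self_iff, mixedCrossingAt_self_iff]
  constructor
  · rintro ⟨⟨h0, h1, h2⟩, h3, h4, h5, h6⟩
    obtain ⟨h5', h6'⟩ := hp.mp ⟨h5, h6⟩
    funext r
    fin_cases r
    · simpa [mixedVec] using h0
    · simpa [mixedVec] using h1
    · simpa [mixedVec] using h2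
    · simpa [mixedVec] using h3
    · simpa [mixedVec] using h4
    · simpa [mixedVec] using h5'
    · simpa [mixedVec] using h6'
  · intro h
    have hr : ∀ r, mixedVec N Δφ Δs GSφφ GSss GSφs GT GA GV₁ GV₂ u v r = 0 := fun r => by
      rw [h, Pi.zero_apply]
    have e5 : Fm ((Δφ + Δs) / 2) GSφs u v + Fm Δφ GV₂ u v = 0 := by simpa [mixedVec] using hr 5
    have e6 : Fp ((Δφ + Δs) / 2) GSφs u v - Fp Δφ GV₂ u v = 0 := by
      have := hr 6
      simp only [mixedVec] at this
      simpa [sub_eq_zero] using this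
    obtain ⟨h5, h6⟩ := hp.mpr ⟨e5, e6⟩
    refine ⟨⟨?_, ?_, ?_⟩, ?_, ?_, h5, h6⟩
    · simpa [mixedVec] using hr 0
    · simpa [mixedVec] using hr 1
    · simpa [mixedVec] using hr 2
    · simpa [mixedVec] using hr 3
    · simpa [mixedVec] using hr 4

/-! ## §3 Operator level: the channel expansions pass through `V⃗_T, V⃗_A, V⃗_V` and the singlet term -/

section Series

variable {ι : Type*} {p : ι → ℝ} {g : ι → ℝ → ℝ → ℝ} {G : ℝ → ℝ → ℝ} {u v : ℝ}

/-- `Σ_𝒪 λ² V⃗_T[g_𝒪] = V⃗_T[G_T]` for a channel expansion converging at `(u,v)` and `(v,u)`.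
[cite: KosPolandSimmonsDuffinVichi2015, §2.1 (vector equation)] -/
theorem hasSum_V7T (Δφ : ℝ) (h1 : HasSum (fun o => p o * g o u v) (G u v))
    (h2 : HasSum (fun o => p o * g o v u) (G v u)) :
    HasSum (fun o => p o • V7T N Δφ (g o) u v) (V7T N Δφ G u v) := by
  rw [Pi.hasSum]
  intro r
  fin_cases r
  · simpa [V7T] using hasSum_Fm Δφ h1 h2
  · have := (hasSum_Fm Δφ h1 h2).mul_left (1 - 2 / (N : ℝ))
    simpa [V7T, mul_left_comm] using this
  · have := (hasSum_Fp Δφ h1 h2).mul_left (-(1 + 2 / (N : ℝ)))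
    simpa [V7T, mul_left_comm] using this
  · simp [V7T]
  · simp [V7T]
  · simp [V7T]
  · simp [V7T]

/-- `Σ_𝒪 λ² V⃗_A[g_𝒪] = V⃗_A[G_A]`. [cite: KosPolandSimmonsDuffinVichi2015, §2.1 (vector equation)] -/
theorem hasSum_V7A (Δφ : ℝ) (h1 : HasSum (fun o => p o * g o u v) (G u v))
    (h2 : HasSum (fun o => p o * g o v u) (G v u)) :
    HasSum (fun o => p o • V7A Δφ (g o) u v) (V7A Δφ G u v) := by
  rw [Pi.hasSum]
  intro r
  fin_cases r
  · simpa [V7A] using hasSum_Fm Δφ h1 h2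
  · have := (hasSum_Fm Δφ h1 h2).neg
    simpa [V7A, mul_neg] using this
  · simpa [V7A] using hasSum_Fp Δφ h1 h2
  · simp [V7A]
  · simp [V7A]
  · simp [V7A]
  · simp [V7A]

/-- `Σ_𝒪 λ² V⃗_V[ε_𝒪; g₁,𝒪, g₂,𝒪] = vectorVec[G_{V,1}, G_{V,2}]`, given the expansions `Σ λ² g₁ → G_{V,1}` and
`Σ ε λ² g₂ → G_{V,2}` at `(u,v)` and `(v,u)`. [cite: KosPolandSimmonsDuffinVichi2015, §2.1 (vector equation)] -/
theorem hasSum_V7V (Δφ Δs : ℝ) {ε : ι → ℝ} {g₁ g₂ : ι → ℝ → ℝ → ℝ} {G₁ G₂ : ℝ → ℝ → ℝ}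
    (h1 : HasSum (fun o => p o * g₁ o u v) (G₁ u v)) (h1' : HasSum (fun o => p o * g₁ o v u) (G₁ v u))
    (h2 : HasSum (fun o => p o * ε o * g₂ o u v) (G₂ u v))
    (h2' : HasSum (fun o => p o * ε o * g₂ o v u) (G₂ v u)) :
    HasSum (fun o => p o • V7V Δφ Δs (ε o) (g₁ o) (g₂ o) u v) (vectorVec Δφ Δs G₁ G₂ u v) := by
  rw [Pi.hasSum]
  intro r
  fin_cases r
  · simp [V7V, vectorVec]
  · simp [V7V, vectorVec]
  · simp [V7V, vectorVec]
  · simp [V7V, vectorVec]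
  · simpa [V7V, vectorVec] using hasSum_Fm ((Δφ + Δs) / 2) h1 h1'
  · have := hasSum_Fm Δφ h2 h2'
    simpa [V7V, vectorVec, mul_assoc] using this
  · have := (hasSum_Fp Δφ h2 h2').neg
    simpa [V7V, vectorVec, mul_assoc, mul_neg, neg_mul] using this

/-- `Σ_{S} (λ_{φφ𝒪} λ_{ss𝒪}) V⃗_S[g_𝒪] (λ_{φφ𝒪}; λ_{ss𝒪}) = singletVec[G^{φφ}, G^{φs}, G^{ss}]`, given the three singlet
channel expansions `Σ a² g`, `Σ ab g`, `Σ b² g` at `(u,v)` and `(v,u)`.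
[cite: KosPolandSimmonsDuffinVichi2015, §2.1 (vector equation)] -/
theorem hasSum_quadVS (Δφ Δs : ℝ) {a b : ι → ℝ} {G₁₁ G₁₂ G₂₂ : ℝ → ℝ → ℝ}
    (h11 : HasSum (fun o => a o ^ 2 * g o u v) (G₁₁ u v))
    (h11' : HasSum (fun o => a o ^ 2 * g o v u) (G₁₁ v u))
    (h12 : HasSum (fun o => a o * b o * g o u v) (G₁₂ u v))
    (h12' : HasSum (fun o => a o * b o * g o v u) (G₁₂ v u))
    (h22 : HasSum (fun o => b o ^ 2 * g o u v) (G₂₂ u v))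
    (h22' : HasSum (fun o => b o ^ 2 * g o v u) (G₂₂ v u)) :
    HasSum (fun o => quadVS Δφ Δs (a o) (b o) (g o) u v) (singletVec Δφ Δs G₁₁ G₁₂ G₂₂ u v) := by
  simp only [quadVS_eq]
  rw [Pi.hasSum]
  intro r
  fin_cases r
  · simp [singletVec]
  · simpa [singletVec] using hasSum_Fm Δφ h11 h11'
  · simpa [singletVec] using hasSum_Fp Δφ h11 h11'
  · simpa [singletVec] using hasSum_Fm Δs h22 h22'
  · simp [singletVec]
  · simpa [singletVec] using hasSum_Fm ((Δφ + Δs) / 2) h12 h12'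
  · simpa [singletVec] using hasSum_Fp ((Δφ + Δs) / 2) h12 h12'

end Series

/-- **The vector equation, series form** (`2 ≤ N`): if the seven channel expansions converge at `(u,v)`
and `(v,u)` and the system is crossing symmetric at `(u,v)`, then
`Σ_{S} (λ_{φφ} λ_{ss}) V⃗_S (λ_{φφ}; λ_{ss}) + Σ_{T} λ² V⃗_T + Σ_{A} λ² V⃗_A + Σ_{V} λ² V⃗_V = 0` there — each series
converging to its channel-level vector and the four limits adding to zero.
[cite: KosPolandSimmonsDuffinVichi2015, §2.1 (vector equation)] -/
theorem mixedSumRule_hasSum (hN : 2 ≤ N) {ιS ιT ιA ιV : Type*} {a b : ιS → ℝ} {pT : ιT → ℝ}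
    {pA : ιA → ℝ} {pV ε : ιV → ℝ} {gS : ιS → ℝ → ℝ → ℝ} {gT : ιT → ℝ → ℝ → ℝ}
    {gA : ιA → ℝ → ℝ → ℝ} {gV₁ gV₂ : ιV → ℝ → ℝ → ℝ} {GSφφ GSss GSφs GT GA GV₁ GV₂ : ℝ → ℝ → ℝ}
    {u v : ℝ} (Δφ Δs : ℝ)
    (hSφφ : HasSum (fun o => a o ^ 2 * gS o u v) (GSφφ u v))
    (hSφφ' : HasSum (fun o => a o ^ 2 * gS o v u) (GSφφ v u))
    (hSφs : HasSum (fun o => a o * b o * gS o u v) (GSφs u v))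
    (hSφs' : HasSum (fun o => a o * b o * gS o v u) (GSφs v u))
    (hSss : HasSum (fun o => b o ^ 2 * gS o u v) (GSss u v))
    (hSss' : HasSum (fun o => b o ^ 2 * gS o v u) (GSss v u))
    (hT : HasSum (fun o => pT o * gT o u v) (GT u v)) (hT' : HasSum (fun o => pT o * gT o v u) (GT v u))
    (hA : HasSum (fun o => pA o * gA o u v) (GA u v)) (hA' : HasSum (fun o => pA o * gA o v u) (GA v u))
    (hV₁ : HasSum (fun o => pV o * gV₁ o u v) (GV₁ u v))
    (hV₁' : HasSum (fun o => pV o * gV₁ o v u) (GV₁ v u))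
    (hV₂ : HasSum (fun o => pV o * ε o * gV₂ o u v) (GV₂ u v))
    (hV₂' : HasSum (fun o => pV o * ε o * gV₂ o v u) (GV₂ v u))
    (hx : SystemCrossingAt N Δφ Δs GSφφ GSss GSφs GT GA GV₁ GV₂ u v) :
    HasSum (fun o => quadVS Δφ Δs (a o) (b o) (gS o) u v) (singletVec Δφ Δs GSφφ GSφs GSss u v) ∧
      HasSum (fun o => pT o • V7T N Δφ (gT o) u v) (V7T N Δφ GT u v) ∧
      HasSum (fun o => pA o • V7A Δφ (gA o) u v) (V7A Δφ GA u v) ∧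
      HasSum (fun o => pV o • V7V Δφ Δs (ε o) (gV₁ o) (gV₂ o) u v) (vectorVec Δφ Δs GV₁ GV₂ u v) ∧
      singletVec Δφ Δs GSφφ GSφs GSss u v + V7T N Δφ GT u v + V7A Δφ GA u v +
          vectorVec Δφ Δs GV₁ GV₂ u v = 0 := by
  refine ⟨hasSum_quadVS Δφ Δs hSφφ hSφφ' hSφs hSφs' hSss hSss', hasSum_V7T Δφ hT hT',
    hasSum_V7A Δφ hA hA', hasSum_V7V Δφ Δs hV₁ hV₁' hV₂ hV₂', ?_⟩
  rw [← mixedVec_eq_parts]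
  exact (systemCrossingAt_iff hN).mp hx

/-! ## §4 The semidefinite exclusion step (source §2.2) -/

/-- `α⃗·V⃗_S[g]`: the functional applied entrywise to the matrix vector — the real symmetric `2 × 2` matrix
`[[α(V₁₁), α(V₁₂)], [α(V₁₂), α(V₂₂)]]`.  A functional is taken to act on 7-vectors of channel functions at
once (`α⃗·V⃗ = Σᵣ αᵣ(Vᵣ)` is the case of a decomposable `α`). [cite: KosPolandSimmonsDuffinVichi2015, §2.2 (`α⃗·V⃗_S ⪰ 0`)] -/
def alphaVS (α : (ℝ → ℝ → Fin 7 → ℝ) →ₗ[ℝ] ℝ) (Δφ Δs : ℝ) (g : ℝ → ℝ → ℝ) :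
    Matrix (Fin 2) (Fin 2) ℝ :=
  !![α (VS11 Δφ g), α (VS12 Δφ Δs g); α (VS12 Δφ Δs g), α (VS22 Δs g)]

/-- `(a b) (α⃗·V⃗_S[g]) (a b)ᵀ = α⃗·((a b) V⃗_S[g] (a b)ᵀ)` (linearity).
[cite: KosPolandSimmonsDuffinVichi2015, §2.2 (`α⃗·V⃗_S ⪰ 0`)] -/
theorem alphaVS_quadForm (α : (ℝ → ℝ → Fin 7 → ℝ) →ₗ[ℝ] ℝ) (Δφ Δs a b : ℝ) (g : ℝ → ℝ → ℝ) :
    ![a, b] ⬝ᵥ (alphaVS α Δφ Δs g *ᵥ ![a, b]) = α (quadVS Δφ Δs a b g) := by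
  simp only [quadVS_eq_smul, map_add, map_smul, smul_eq_mul]
  simp [alphaVS, Matrix.mulVec, dotProduct, Fin.sum_univ_two]
  ring

/-- **What `⪰ 0` buys**: if `α⃗·V⃗_S[g] ⪰ 0` then the applied singlet term `α((a b) V⃗_S[g] (a b)ᵀ)` is `≥ 0` for
EVERY pair of real couplings `(a, b) = (λ_{φφ𝒪}, λ_{ss𝒪})`, whatever their signs.
[cite: KosPolandSimmonsDuffinVichi2015, §2.2 (`α⃗·V⃗_S ⪰ 0`)] -/
theorem quadVS_nonneg_of_posSemidef (α : (ℝ → ℝ → Fin 7 → ℝ) →ₗ[ℝ] ℝ) {Δφ Δs : ℝ} {g : ℝ → ℝ → ℝ}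
    (h : (alphaVS α Δφ Δs g).PosSemidef) (a b : ℝ) : 0 ≤ α (quadVS Δφ Δs a b g) := by
  have := h.dotProduct_mulVec_nonneg ![a, b]
  rwa [star_trivial, alphaVS_quadForm] at this

/-- **The exclusion argument** (abstract form).  Data: singlets `𝒪 ∈ ιS` OTHER than the unit with real
couplings `(a, b)` and channel functions `gS`; `T`, `A`, `V` families with weights `λ² ≥ 0` (and signs `ε`
for `V`); channel sums with the unit INCLUDED in `G^{φφ}_S, G^{φs}_S, G^{ss}_S`.  Hypotheses: `α` APPLIES
TERMWISE to the four channel series (`hS`, `hT`, `hA`, `hV` — automatic for point functionals,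
`hasSum_pointFunctional₇`; an analytic obligation for derivative functionals); `α` annihilates the
channel-level sum rule (`hzero`, e.g. because the seven equations hold wherever `α` looks); and the five
conditions of §2.2 — `(1 1) α⃗·V⃗_{S,0,0} (1 1)ᵀ > 0` (strict, see the module docstring), `α⃗·V⃗_T ≥ 0`,
`α⃗·V⃗_A ≥ 0`, `α⃗·V⃗_V ≥ 0` on the exchanged operators, `α⃗·V⃗_S ⪰ 0` on the exchanged singlets.  Conclusion:
contradiction. [cite: KosPolandSimmonsDuffinVichi2015, §2.2 (functional conditions)] -/
theorem false_of_functional₇ (α : (ℝ → ℝ → Fin 7 → ℝ) →ₗ[ℝ] ℝ) {Δφ Δs : ℝ} {ιS ιT ιA ιV : Type*}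
    {a b : ιS → ℝ} {pT : ιT → ℝ} {pA : ιA → ℝ} {pV ε : ιV → ℝ} {gS : ιS → ℝ → ℝ → ℝ}
    {gT : ιT → ℝ → ℝ → ℝ} {gA : ιA → ℝ → ℝ → ℝ} {gV₁ gV₂ : ιV → ℝ → ℝ → ℝ}
    {GSφφ GSss GSφs GT GA GV₁ GV₂ : ℝ → ℝ → ℝ}
    (hpT : ∀ o, 0 ≤ pT o) (hpA : ∀ o, 0 ≤ pA o) (hpV : ∀ o, 0 ≤ pV o)
    (hS : HasSum (fun o => α (quadVS Δφ Δs (a o) (b o) (gS o)))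
      (α (singletVec Δφ Δs (fun u v => GSφφ u v - 1) (fun u v => GSφs u v - 1)
        fun u v => GSss u v - 1)))
    (hT : HasSum (fun o => pT o * α (V7T N Δφ (gT o))) (α (V7T N Δφ GT)))
    (hA : HasSum (fun o => pA o * α (V7A Δφ (gA o))) (α (V7A Δφ GA)))
    (hV : HasSum (fun o => pV o * α (V7V Δφ Δs (ε o) (gV₁ o) (gV₂ o)))
      (α (vectorVec Δφ Δs GV₁ GV₂)))
    (hzero : α (mixedVec N Δφ Δs GSφφ GSss GSφs GT GA GV₁ GV₂) = 0)
    (hunit : 0 < ![(1 : ℝ), 1] ⬝ᵥ (alphaVS α Δφ Δs (fun _ _ => (1 : ℝ)) *ᵥ ![(1 : ℝ), 1]))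
    (hposT : ∀ o, 0 ≤ α (V7T N Δφ (gT o))) (hposA : ∀ o, 0 ≤ α (V7A Δφ (gA o)))
    (hposV : ∀ o, 0 ≤ α (V7V Δφ Δs (ε o) (gV₁ o) (gV₂ o)))
    (hposS : ∀ o, (alphaVS α Δφ Δs (gS o)).PosSemidef) : False := by
  have nS : 0 ≤ α (singletVec Δφ Δs (fun u v => GSφφ u v - 1) (fun u v => GSφs u v - 1)
      fun u v => GSss u v - 1) :=
    hS.nonneg fun o => quadVS_nonneg_of_posSemidef α (hposS o) (a o) (b o)
  have nT : 0 ≤ α (V7T N Δφ GT) := hT.nonneg fun o => mul_nonneg (hpT o) (hposT o)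
  have nA : 0 ≤ α (V7A Δφ GA) := hA.nonneg fun o => mul_nonneg (hpA o) (hposA o)
  have nV : 0 ≤ α (vectorVec Δφ Δs GV₁ GV₂) := hV.nonneg fun o => mul_nonneg (hpV o) (hposV o)
  rw [alphaVS_quadForm] at hunit
  rw [mixedVec_unit_split, map_add, map_add, map_add, map_add] at hzero
  linarith

/-- A finite combination of point evaluations of the seven components,
`α(F) = Σ_m Σ_r w m r · F(u_m, v_m)_r` for `F : ℝ → ℝ → (Fin 7 → ℝ)` — the seven-component analogue of
the imported `pointFunctional` (crossing imposed point by point, Hogervorst–Rychkov 2013, §4.3); the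
simplest members of the source's "vector of linear functionals".
[cite: HogervorstRychkov2013, §4.3] [cite: KosPolandSimmonsDuffinVichi2015, §2.2 (functional conditions)] -/
def pointFunctional₇ {M : ℕ} (w : Fin M → Fin 7 → ℝ) (u v : Fin M → ℝ) :
    (ℝ → ℝ → Fin 7 → ℝ) →ₗ[ℝ] ℝ where
  toFun F := ∑ m, ∑ r, w m r * F (u m) (v m) r
  map_add' F F' := by
    simp only [Pi.add_apply, mul_add, Finset.sum_add_distrib]
  map_smul' c F := by
    simp only [Pi.smul_apply, smul_eq_mul, RingHom.id_apply, Finset.mul_sum]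
    refine Finset.sum_congr rfl fun m _ => Finset.sum_congr rfl fun r _ => ?_
    ring

/-- Unfolding of `pointFunctional₇`. [cite: HogervorstRychkov2013, §4.3] -/
theorem pointFunctional₇_apply {M : ℕ} (w : Fin M → Fin 7 → ℝ) (u v : Fin M → ℝ)
    (F : ℝ → ℝ → Fin 7 → ℝ) : pointFunctional₇ w u v F = ∑ m, ∑ r, w m r * F (u m) (v m) r := rfl

/-- Point functionals apply termwise: pointwise convergence of a vector-valued series at the evaluation
points gives convergence of the applied series, with no further hypothesis.
[cite: KosPolandSimmonsDuffinVichi2015, §2.2 (functional conditions)] -/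
theorem hasSum_pointFunctional₇ {M : ℕ} (w : Fin M → Fin 7 → ℝ) (u v : Fin M → ℝ) {ι : Type*}
    {f : ι → ℝ → ℝ → Fin 7 → ℝ} {F : ℝ → ℝ → Fin 7 → ℝ}
    (h : ∀ m, HasSum (fun o => f o (u m) (v m)) (F (u m) (v m))) :
    HasSum (fun o => pointFunctional₇ w u v (f o)) (pointFunctional₇ w u v F) := by
  simp only [pointFunctional₇_apply]
  refine hasSum_sum fun m _ => hasSum_sum fun r _ => ?_
  exact ((Pi.hasSum.mp (h m)) r).mul_left (w m r)

/-- **Exclusion by a point functional, all hypotheses explicit** (`2 ≤ N`).  Data: singlets OTHER than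
the unit (`ιS`; real couplings `a = λ_{φφ𝒪}`, `b = λ_{ss𝒪}`, channel function `gS`), traceless symmetric
(`ιT`, `λ² = pT ≥ 0`), antisymmetric (`ιA`), `O(N)` vectors (`ιV`, `λ²_{φs} = pV ≥ 0`, signs `ε`, channel
functions `gV₁, gV₂`); channel sums `G^{φφ}_S, G^{ss}_S, G^{φs}_S` INCLUDING the unit contribution `1`,
`G_T, G_A, G_{V,1}, G_{V,2}`; evaluation points `(u_m, v_m)`.  Hypotheses: the seven channel expansions
converge at every `(u_m, v_m)` and `(v_m, u_m)`; the system is crossing symmetric at every `(u_m, v_m)`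
(`SystemCrossingAt`, which includes `⟨φφss⟩` at the mirror points); and for `α = pointFunctional₇ w u v`
the five conditions of §2.2 hold — `(1 1) α⃗·V⃗_{S,0,0} (1 1)ᵀ > 0`, `α⃗·V⃗_T[g_𝒪] ≥ 0` (`𝒪 ∈ ιT`),
`α⃗·V⃗_A[g_𝒪] ≥ 0`, `α⃗·V⃗_V[ε_𝒪; g₁, g₂] ≥ 0`, `α⃗·V⃗_S[g_𝒪] ⪰ 0` (`𝒪 ∈ ιS`).  Conclusion: contradiction — the
assumed spectrum (encoded by the index sets) is ruled out.
[cite: KosPolandSimmonsDuffinVichi2015, §2.2 (functional conditions)] -/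
theorem false_of_pointFunctional₇ (hN : 2 ≤ N) {M : ℕ} (w : Fin M → Fin 7 → ℝ) (u v : Fin M → ℝ)
    {Δφ Δs : ℝ} {ιS ιT ιA ιV : Type*} {a b : ιS → ℝ} {pT : ιT → ℝ} {pA : ιA → ℝ} {pV ε : ιV → ℝ}
    {gS : ιS → ℝ → ℝ → ℝ} {gT : ιT → ℝ → ℝ → ℝ} {gA : ιA → ℝ → ℝ → ℝ} {gV₁ gV₂ : ιV → ℝ → ℝ → ℝ}
    {GSφφ GSss GSφs GT GA GV₁ GV₂ : ℝ → ℝ → ℝ}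
    (hpT : ∀ o, 0 ≤ pT o) (hpA : ∀ o, 0 ≤ pA o) (hpV : ∀ o, 0 ≤ pV o)
    (hSφφ : ∀ m, HasSum (fun o => a o ^ 2 * gS o (u m) (v m)) (GSφφ (u m) (v m) - 1))
    (hSφφ' : ∀ m, HasSum (fun o => a o ^ 2 * gS o (v m) (u m)) (GSφφ (v m) (u m) - 1))
    (hSφs : ∀ m, HasSum (fun o => a o * b o * gS o (u m) (v m)) (GSφs (u m) (v m) - 1))
    (hSφs' : ∀ m, HasSum (fun o => a o * b o * gS o (v m) (u m)) (GSφs (v m) (u m) - 1))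
    (hSss : ∀ m, HasSum (fun o => b o ^ 2 * gS o (u m) (v m)) (GSss (u m) (v m) - 1))
    (hSss' : ∀ m, HasSum (fun o => b o ^ 2 * gS o (v m) (u m)) (GSss (v m) (u m) - 1))
    (hT : ∀ m, HasSum (fun o => pT o * gT o (u m) (v m)) (GT (u m) (v m)))
    (hT' : ∀ m, HasSum (fun o => pT o * gT o (v m) (u m)) (GT (v m) (u m)))
    (hA : ∀ m, HasSum (fun o => pA o * gA o (u m) (v m)) (GA (u m) (v m)))
    (hA' : ∀ m, HasSum (fun o => pA o * gA o (v m) (u m)) (GA (v m) (u m)))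
    (hV₁ : ∀ m, HasSum (fun o => pV o * gV₁ o (u m) (v m)) (GV₁ (u m) (v m)))
    (hV₁' : ∀ m, HasSum (fun o => pV o * gV₁ o (v m) (u m)) (GV₁ (v m) (u m)))
    (hV₂ : ∀ m, HasSum (fun o => pV o * ε o * gV₂ o (u m) (v m)) (GV₂ (u m) (v m)))
    (hV₂' : ∀ m, HasSum (fun o => pV o * ε o * gV₂ o (v m) (u m)) (GV₂ (v m) (u m)))
    (hx : ∀ m, SystemCrossingAt N Δφ Δs GSφφ GSss GSφs GT GA GV₁ GV₂ (u m) (v m))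
    (hunit : 0 < ![(1 : ℝ), 1] ⬝ᵥ
      (alphaVS (pointFunctional₇ w u v) Δφ Δs (fun _ _ => (1 : ℝ)) *ᵥ ![(1 : ℝ), 1]))
    (hposT : ∀ o, 0 ≤ pointFunctional₇ w u v (V7T N Δφ (gT o)))
    (hposA : ∀ o, 0 ≤ pointFunctional₇ w u v (V7A Δφ (gA o)))
    (hposV : ∀ o, 0 ≤ pointFunctional₇ w u v (V7V Δφ Δs (ε o) (gV₁ o) (gV₂ o)))
    (hposS : ∀ o, (alphaVS (pointFunctional₇ w u v) Δφ Δs (gS o)).PosSemidef) : False := by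
  refine false_of_functional₇ (pointFunctional₇ w u v) hpT hpA hpV ?_ ?_ ?_ ?_ ?_ hunit hposT hposA
    hposV hposS (a := a) (b := b) (GSφφ := GSφφ) (GSss := GSss) (GSφs := GSφs) (GT := GT)
    (GA := GA) (GV₁ := GV₁) (GV₂ := GV₂)
  · -- the singlet series: `α` applied to `Σ (a b) V⃗_S (a b)ᵀ`
    exact hasSum_pointFunctional₇ w u v (f := fun o => quadVS Δφ Δs (a o) (b o) (gS o))
      (F := singletVec Δφ Δs (fun u' v' => GSφφ u' v' - 1) (fun u' v' => GSφs u' v' - 1)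
        fun u' v' => GSss u' v' - 1)
      fun m => hasSum_quadVS Δφ Δs (G₁₁ := fun u' v' => GSφφ u' v' - 1)
        (G₁₂ := fun u' v' => GSφs u' v' - 1) (G₂₂ := fun u' v' => GSss u' v' - 1)
        (hSφφ m) (hSφφ' m) (hSφs m) (hSφs' m) (hSss m) (hSss' m)
  · -- the `T` series
    have := hasSum_pointFunctional₇ w u v (f := fun o => pT o • V7T N Δφ (gT o)) (F := V7T N Δφ GT)
      fun m => hasSum_V7T Δφ (hT m) (hT' m)
    simpa [map_smul, smul_eq_mul] using this
  · -- the `A` series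
    have := hasSum_pointFunctional₇ w u v (f := fun o => pA o • V7A Δφ (gA o)) (F := V7A Δφ GA)
      fun m => hasSum_V7A Δφ (hA m) (hA' m)
    simpa [map_smul, smul_eq_mul] using this
  · -- the `V` series
    have := hasSum_pointFunctional₇ w u v (f := fun o => pV o • V7V Δφ Δs (ε o) (gV₁ o) (gV₂ o))
      (F := vectorVec Δφ Δs GV₁ GV₂) fun m => hasSum_V7V Δφ Δs (hV₁ m) (hV₁' m) (hV₂ m) (hV₂' m)
    simpa [map_smul, smul_eq_mul] using this
  · -- the seven equations hold at every evaluation point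
    rw [pointFunctional₇_apply]
    refine Finset.sum_eq_zero fun m _ => Finset.sum_eq_zero fun r _ => ?_
    have := (systemCrossingAt_iff hN).mp (hx m)
    rw [this, Pi.zero_apply, mul_zero]

end

end Literature.MathematicalPhysics.QuantumFieldTheory.ONMixedSumRule
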